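import Mathlib
import Literature.Analysis.FluidPDE.VectorCalculus

/-!
# `SkeletonEquilibrium` (stmt-NavierStokesRegularity-15400), line `mirror-point-negation`:
# the ripple functional is Lipschitz

Tools stub `stub_rippleLipschitz` (shared with line `zero-accretion-selection`). The negation lines
reduce every witness filament, in outer units, to a solution `Y` of the outer ODE
`Y″ = β Y′ × (½Y − α e₃×Y)`; the RIPPLE FUNCTIONAL
`q_β(Y, T) = ‖T − c b − (c/β/‖B‖²) • b × Bt‖ · ‖Y‖`
(`B = ½Y − α e₃×Y` the frame drift, `b = B/‖B‖`, `Bt = ½T − α e₃×T`, `c = ⟪T, b⟫`) measures the free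
gyration of the unit tangent `T` about the drift direction with the first-order slaved part removed.
This file proves the purely finite-dimensional fact that `q_β` is Lipschitz in `(Y, T)` on the region
`R₁/2 ≤ ‖Y‖ ≤ 2R₃`, `‖T‖ ≤ 1`, uniformly for `βmin ≤ |β| ≤ βmax`, with an explicit constant
`Cq = Cq(α, βmin, R₁, R₃)`. Key point: the drift has no kernel, `⟪B, Y⟫ = ½‖Y‖²`, so
`‖B‖ ≥ ‖Y‖/2 ≥ R₁/4 > 0` on the region; everything else is the product rule for differences.
-/

noncomputable section

namespace Summit.NavierStokesRegularity.NavierStokesRegularity.Theorems.SkeletonEquilibrium.MirrorPointNegation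
set_option linter.dupNamespace false

open Literature.Analysis.FluidPDE
open scoped RealInnerProductSpace InnerProductSpace

/-! ## Elementary cross-product facts -/

/-- `‖v × w‖ ≤ ‖v‖ ‖w‖` (from the Literature identity `norm_cross`). [folklore] -/
private theorem norm_cross_le (v w : EuclideanSpace ℝ (Fin 3)) : ‖cross v w‖ ≤ ‖v‖ * ‖w‖ := by
  rw [norm_cross]
  have h1 : Real.sin (InnerProductGeometry.angle v w) ≤ 1 := Real.sin_le_one _
  have h2 : 0 ≤ ‖v‖ * ‖w‖ := by positivity
  nlinarith

/-- `(v − v′) × w = v × w − v′ × w` (bilinearity, via the bundled `crossCLM`). [folklore] -/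
private theorem cross_sub_left (v v' w : EuclideanSpace ℝ (Fin 3)) :
    cross (v - v') w = cross v w - cross v' w := by
  rw [← crossCLM_apply, ← crossCLM_apply, ← crossCLM_apply]
  exact crossCLM.map_sub₂ v v' w

/-- `u × (v − w) = u × v − u × w` (bilinearity, via the bundled `crossCLM`). [folklore] -/
private theorem cross_sub_right (u v w : EuclideanSpace ℝ (Fin 3)) :
    cross u (v - w) = cross u v - cross u w := by
  rw [← crossCLM_apply, ← crossCLM_apply, ← crossCLM_apply]
  exact (crossCLM u).map_sub v w

/-- `‖u × v − u′ × v′‖ ≤ ‖u − u′‖ ‖v‖ + ‖u′‖ ‖v − v′‖` (product rule for differences). [folklore] -/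
private theorem norm_cross_sub_cross_le (u v u' v' : EuclideanSpace ℝ (Fin 3)) :
    ‖cross u v - cross u' v'‖ ≤ ‖u - u'‖ * ‖v‖ + ‖u'‖ * ‖v - v'‖ := by
  have h : cross u v - cross u' v' = cross (u - u') v + cross u' (v - v') := by
    rw [cross_sub_left, cross_sub_right]; abel
  rw [h]
  exact (norm_add_le _ _).trans (add_le_add (norm_cross_le _ _) (norm_cross_le _ _))

/-- `⟪a × b, b⟫ = 0`: a cross product is orthogonal to its second factor. [folklore] -/
private theorem inner_cross_self_right (a b : EuclideanSpace ℝ (Fin 3)) : ⟪cross a b, b⟫ = 0 := by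
  simp only [cross, PiLp.inner_apply, RCLike.inner_apply, conj_trivial, Fin.sum_univ_three,
    cross_apply, Matrix.cons_val_zero, Matrix.cons_val_one, Matrix.cons_val_two,
    Matrix.head_cons, Matrix.tail_cons]
  ring

/-- `‖e × Y‖ ≤ ‖Y‖` for a unit vector `e`. [folklore] -/
private theorem norm_cross_unit_le {e : EuclideanSpace ℝ (Fin 3)} (he : ‖e‖ = 1)
    (Y : EuclideanSpace ℝ (Fin 3)) : ‖cross e Y‖ ≤ ‖Y‖ := by
  have h := norm_cross_le e Y
  rwa [he, one_mul] at h

/-! ## The frame drift `B(Y) = ½Y − α e×Y` (`e = e₃` a unit vector) -/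

/-- Upper bound `‖½Y − α e×Y‖ ≤ (½ + |α|) ‖Y‖` for a unit vector `e`. [folklore] -/
private theorem norm_drift_le (α : ℝ) {e : EuclideanSpace ℝ (Fin 3)} (he : ‖e‖ = 1)
    (Y : EuclideanSpace ℝ (Fin 3)) :
    ‖(1 / 2 : ℝ) • Y - α • cross e Y‖ ≤ (1 / 2 + |α|) * ‖Y‖ := by
  calc ‖(1 / 2 : ℝ) • Y - α • cross e Y‖ ≤ ‖(1 / 2 : ℝ) • Y‖ + ‖α • cross e Y‖ := norm_sub_le _ _
    _ = 1 / 2 * ‖Y‖ + |α| * ‖cross e Y‖ := by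
        rw [norm_smul, norm_smul, Real.norm_eq_abs, Real.norm_eq_abs,
          abs_of_pos (by norm_num : (0 : ℝ) < 1 / 2)]
    _ ≤ 1 / 2 * ‖Y‖ + |α| * ‖Y‖ := by gcongr; exact norm_cross_unit_le he Y
    _ = (1 / 2 + |α|) * ‖Y‖ := by ring

/-- Lower bound `‖Y‖/2 ≤ ‖½Y − α e×Y‖`: the drift has no kernel, because `⟪½Y − α e×Y, Y⟫ = ½‖Y‖²`
and Cauchy–Schwarz. [folklore] -/
private theorem half_norm_le_norm_drift (α : ℝ) (e Y : EuclideanSpace ℝ (Fin 3)) :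
    ‖Y‖ / 2 ≤ ‖(1 / 2 : ℝ) • Y - α • cross e Y‖ := by
  have h1 : ⟪(1 / 2 : ℝ) • Y - α • cross e Y, Y⟫ = 1 / 2 * ‖Y‖ ^ 2 := by
    rw [inner_sub_left, real_inner_smul_left, real_inner_smul_left, inner_cross_self_right,
      real_inner_self_eq_norm_sq]
    ring
  have h2 := real_inner_le_norm ((1 / 2 : ℝ) • Y - α • cross e Y) Y
  rw [h1] at h2
  rcases (norm_nonneg Y).eq_or_lt with h | h
  · rw [← h]; simp
  · by_contra hlt
    nlinarith [mul_lt_mul_of_pos_right (not_le.mp hlt) h]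

/-- Linearity of the drift: `B(Y) − B(Y′) = B(Y − Y′)`. [folklore] -/
private theorem drift_sub (α : ℝ) (e Y Y' : EuclideanSpace ℝ (Fin 3)) :
    ((1 / 2 : ℝ) • Y - α • cross e Y) - ((1 / 2 : ℝ) • Y' - α • cross e Y') =
      (1 / 2 : ℝ) • (Y - Y') - α • cross e (Y - Y') := by
  rw [cross_sub_right, smul_sub, smul_sub]
  abel

/-! ## Product rules for differences -/

/-- Normalisation is Lipschitz away from the origin:
`‖u/‖u‖ − v/‖v‖‖ ≤ 2‖u − v‖/‖u‖` for `u, v ≠ 0`. [folklore] -/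
private theorem norm_unit_sub_unit_le {E : Type*} [NormedAddCommGroup E] [NormedSpace ℝ E]
    {u v : E} (hu : 0 < ‖u‖) (hv : 0 < ‖v‖) :
    ‖‖u‖⁻¹ • u - ‖v‖⁻¹ • v‖ ≤ 2 * ‖u - v‖ / ‖u‖ := by
  have key : ‖u‖⁻¹ • u - ‖v‖⁻¹ • v = ‖u‖⁻¹ • (u - v) + (‖u‖⁻¹ - ‖v‖⁻¹) • v := by
    rw [smul_sub, sub_smul]; abel
  rw [key]
  calc ‖‖u‖⁻¹ • (u - v) + (‖u‖⁻¹ - ‖v‖⁻¹) • v‖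
        ≤ ‖‖u‖⁻¹ • (u - v)‖ + ‖(‖u‖⁻¹ - ‖v‖⁻¹) • v‖ := norm_add_le _ _
    _ = ‖u - v‖ / ‖u‖ + |‖v‖ - ‖u‖| / ‖u‖ := by
        rw [norm_smul, norm_smul, norm_inv, norm_norm, Real.norm_eq_abs, inv_mul_eq_div,
          inv_sub_inv hu.ne' hv.ne', abs_div, abs_of_pos (mul_pos hu hv)]
        field_simp
    _ ≤ ‖u - v‖ / ‖u‖ + ‖u - v‖ / ‖u‖ := by
        gcongr; rw [abs_sub_comm]; exact abs_norm_sub_norm_le u v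
    _ = 2 * ‖u - v‖ / ‖u‖ := by ring

/-- `‖k • v − k′ • v′‖ ≤ |k − k′| ‖v‖ + |k′| ‖v − v′‖`. [folklore] -/
private theorem norm_smul_sub_smul_le {E : Type*} [SeminormedAddCommGroup E] [NormedSpace ℝ E]
    (k k' : ℝ) (v v' : E) : ‖k • v - k' • v'‖ ≤ |k - k'| * ‖v‖ + |k'| * ‖v - v'‖ := by
  have h : k • v - k' • v' = (k - k') • v + k' • (v - v') := by
    rw [sub_smul, smul_sub]; abel
  rw [h]
  refine (norm_add_le _ _).trans (le_of_eq ?_)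
  rw [norm_smul, norm_smul, Real.norm_eq_abs, Real.norm_eq_abs]

/-- `|x y − x′ y′| ≤ |x − x′| |y| + |x′| |y − y′|`. [folklore] -/
private theorem abs_mul_sub_mul_le (x y x' y' : ℝ) :
    |x * y - x' * y'| ≤ |x - x'| * |y| + |x'| * |y - y'| := by
  have h : x * y - x' * y' = (x - x') * y + x' * (y - y') := by ring
  rw [h]
  refine (abs_add_le _ _).trans (le_of_eq ?_)
  rw [abs_mul, abs_mul]

/-- `|⟪T, b⟫ − ⟪T′, b′⟫| ≤ ‖T − T′‖ ‖b‖ + ‖T′‖ ‖b − b′‖`. [folklore] -/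
private theorem abs_inner_sub_inner_le (T b T' b' : EuclideanSpace ℝ (Fin 3)) :
    |⟪T, b⟫ - ⟪T', b'⟫| ≤ ‖T - T'‖ * ‖b‖ + ‖T'‖ * ‖b - b'‖ := by
  have h : ⟪T, b⟫ - ⟪T', b'⟫ = ⟪T - T', b⟫ + ⟪T', b - b'⟫ := by
    rw [inner_sub_left, inner_sub_right]; ring
  rw [h]
  exact (abs_add_le _ _).trans (add_le_add (abs_real_inner_le_norm _ _) (abs_real_inner_le_norm _ _))

/-- `|x⁻² − y⁻²| ≤ |x − y| · 2/m³` for `x, y ≥ m > 0`. [folklore] -/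
private theorem abs_inv_sq_sub_inv_sq_le {x y m : ℝ} (hm : 0 < m) (hx : m ≤ x) (hy : m ≤ y) :
    |(x ^ 2)⁻¹ - (y ^ 2)⁻¹| ≤ |x - y| * (2 / m ^ 3) := by
  have hx0 : 0 < x := hm.trans_le hx
  have hy0 : 0 < y := hm.trans_le hy
  have key : (x ^ 2)⁻¹ - (y ^ 2)⁻¹ = (x⁻¹ - y⁻¹) * (x⁻¹ + y⁻¹) := by ring
  rw [key, abs_mul]
  have h1 : |x⁻¹ - y⁻¹| ≤ |x - y| / m ^ 2 := by
    rw [inv_sub_inv hx0.ne' hy0.ne', abs_div, abs_of_pos (mul_pos hx0 hy0), abs_sub_comm]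
    gcongr
    rw [sq]; exact mul_le_mul hx hy hm.le hx0.le
  have h2 : |x⁻¹ + y⁻¹| ≤ 2 / m := by
    rw [abs_of_pos (by positivity)]
    have hx' : x⁻¹ ≤ m⁻¹ := inv_anti₀ hm hx
    have hy' : y⁻¹ ≤ m⁻¹ := inv_anti₀ hm hy
    calc x⁻¹ + y⁻¹ ≤ m⁻¹ + m⁻¹ := add_le_add hx' hy'
      _ = 2 / m := by ring
  calc |x⁻¹ - y⁻¹| * |x⁻¹ + y⁻¹| ≤ |x - y| / m ^ 2 * (2 / m) :=
        mul_le_mul h1 h2 (abs_nonneg _) (by positivity)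
    _ = |x - y| * (2 / m ^ 3) := by ring

/-! ## The stub -/

/-- **Tools stub `stub_rippleLipschitz`** (lines `mirror-point-negation` / `zero-accretion-selection` of
crux `SkeletonEquilibrium`). The ripple functional
`q_β(Y, T) = ‖T − c b − (c/β/‖B‖²) • b × Bt‖ · ‖Y‖` (`B = ½Y − α e₃×Y`, `b = B/‖B‖`, `Bt = ½T − α e₃×T`,
`c = ⟪T, b⟫`) is LIPSCHITZ in `(Y, T)` on the region `R₁/2 ≤ ‖Y‖ ≤ 2R₃`, `‖T‖ ≤ 1`, uniformly for
`βmin ≤ |β| ≤ βmax`, with a constant depending only on `α, βmin, R₁, R₃`. Proof: on the region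
`‖B‖ ≥ ‖Y‖/2 ≥ R₁/4 > 0` (`half_norm_le_norm_drift`), `‖B‖, ‖Bt‖ ≤ (½ + |α|)·(‖Y‖, ‖T‖)`, `‖b‖ = 1`,
`|c| ≤ 1`; the differences `B − B′`, `b − b′`, `Bt − Bt′`, `c − c′`, `‖B‖⁻² − ‖B′‖⁻²`, … are each
bounded by an explicit multiple of `‖Y − Y′‖ + ‖T − T′‖` by the product rule for differences, and the
constants are collected. [folklore] -/
theorem stub_rippleLipschitz :
    ∀ (α βmin βmax R₁ R₃ : ℝ), 0 < βmin → βmin ≤ βmax → 0 < R₁ → R₁ ≤ R₃ →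
      ∃ Cq : ℝ, 0 ≤ Cq ∧ ∀ β : ℝ, βmin ≤ |β| → |β| ≤ βmax →
        ∀ (Y T Y' T' : EuclideanSpace ℝ (Fin 3)), R₁ / 2 ≤ ‖Y‖ → ‖Y‖ ≤ 2 * R₃ → R₁ / 2 ≤ ‖Y'‖ → ‖Y'‖ ≤ 2 * R₃ →
          ‖T‖ ≤ 1 → ‖T'‖ ≤ 1 →
          ∀ (B b Bt : EuclideanSpace ℝ (Fin 3)) (c : ℝ), B = (1 / 2 : ℝ) • Y - α • cross (EuclideanSpace.single (2 : Fin 3) (1 : ℝ)) (Y) →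
            b = ‖B‖⁻¹ • B → Bt = (1 / 2 : ℝ) • T - α • cross (EuclideanSpace.single (2 : Fin 3) (1 : ℝ)) (T) → c = ⟪T, b⟫ →
          ∀ (B' b' Bt' : EuclideanSpace ℝ (Fin 3)) (c' : ℝ), B' = (1 / 2 : ℝ) • Y' - α • cross (EuclideanSpace.single (2 : Fin 3) (1 : ℝ)) (Y') →
            b' = ‖B'‖⁻¹ • B' → Bt' = (1 / 2 : ℝ) • T' - α • cross (EuclideanSpace.single (2 : Fin 3) (1 : ℝ)) (T') → c' = ⟪T', b'⟫ →
          |‖T - c • b - (c / (β) / ‖B‖ ^ 2) • cross b Bt‖ * ‖Y‖ -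
              ‖T' - c' • b' - (c' / (β) / ‖B'‖ ^ 2) • cross b' Bt'‖ * ‖Y'‖| ≤ Cq * (‖Y - Y'‖ + ‖T - T'‖) := by
  intro α βmin βmax R₁ R₃ hβmin _hββ hR₁ hR₁₃
  have hR₃ : 0 ≤ R₃ := hR₁.le.trans hR₁₃
  have he : ‖(EuclideanSpace.single (2 : Fin 3) (1 : ℝ) : EuclideanSpace ℝ (Fin 3))‖ = 1 := by simp
  -- the constants of the estimate, kept atomic
  obtain ⟨A, hA⟩ : ∃ A : ℝ, A = 1 / 2 + |α| := ⟨_, rfl⟩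
  obtain ⟨m, hm⟩ : ∃ m : ℝ, m = R₁ / 4 := ⟨_, rfl⟩
  have hA0 : 0 < A := by rw [hA]; positivity
  have hm0 : 0 < m := by rw [hm]; positivity
  obtain ⟨K, hK⟩ : ∃ K : ℝ, K = 1 / βmin / m ^ 2 := ⟨_, rfl⟩
  have hK0 : 0 ≤ K := by rw [hK]; positivity
  obtain ⟨c₁, hc₁⟩ : ∃ c₁ : ℝ, c₁ = 2 * A / m := ⟨_, rfl⟩
  have hc₁0 : 0 ≤ c₁ := by rw [hc₁]; positivity
  obtain ⟨c₃, hc₃⟩ : ∃ c₃ : ℝ, c₃ = 1 + c₁ := ⟨_, rfl⟩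
  have hc₃0 : 0 ≤ c₃ := by rw [hc₃]; positivity
  obtain ⟨c₄, hc₄⟩ : ∃ c₄ : ℝ, c₄ = c₁ * A + A := ⟨_, rfl⟩
  have hc₄0 : 0 ≤ c₄ := by rw [hc₄]; positivity
  obtain ⟨c₅, hc₅⟩ : ∃ c₅ : ℝ, c₅ = (c₃ / m ^ 2 + 2 * A / m ^ 3) / βmin := ⟨_, rfl⟩
  have hc₅0 : 0 ≤ c₅ := by rw [hc₅]; positivity
  obtain ⟨c₆, hc₆⟩ : ∃ c₆ : ℝ, c₆ = c₅ * A + K * c₄ := ⟨_, rfl⟩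
  have hc₆0 : 0 ≤ c₆ := by rw [hc₆]; positivity
  obtain ⟨c₇, hc₇⟩ : ∃ c₇ : ℝ, c₇ = 1 + (c₃ + c₁) + c₆ := ⟨_, rfl⟩
  have hc₇0 : 0 ≤ c₇ := by rw [hc₇]; positivity
  refine ⟨c₇ * (2 * R₃) + (2 + K * A), by positivity, ?_⟩
  intro β hβ _hβ' Y T Y' T' hY hY₃ hY' _hY'₃ hT hT' B b Bt c hB hb hBt hc B' b' Bt' c' hB' hb' hBt' hc'
  -- the increment
  obtain ⟨L, hL⟩ : ∃ L : ℝ, L = ‖Y - Y'‖ + ‖T - T'‖ := ⟨_, rfl⟩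
  have hdY : ‖Y - Y'‖ ≤ L := by rw [hL]; linarith [norm_nonneg (T - T')]
  have hdT : ‖T - T'‖ ≤ L := by rw [hL]; linarith [norm_nonneg (Y - Y')]
  have hL0 : 0 ≤ L := (norm_nonneg _).trans hdY
  rw [← hL]
  -- Step 1: the drifts `B`, `B'`
  have hBm : m ≤ ‖B‖ := by
    rw [hB, hm]; linarith [half_norm_le_norm_drift α (EuclideanSpace.single (2 : Fin 3) (1 : ℝ)) Y]
  have hB'm : m ≤ ‖B'‖ := by
    rw [hB', hm]; linarith [half_norm_le_norm_drift α (EuclideanSpace.single (2 : Fin 3) (1 : ℝ)) Y']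
  have hB0 : 0 < ‖B‖ := hm0.trans_le hBm
  have hB'0 : 0 < ‖B'‖ := hm0.trans_le hB'm
  have hBB' : ‖B - B'‖ ≤ A * L := by
    rw [hB, hB', drift_sub, hA]
    exact (norm_drift_le α he (Y - Y')).trans (by gcongr)
  -- Step 2: the unit drifts `b`, `b'`
  have hb1 : ‖b‖ = 1 := by
    rw [hb, norm_smul, norm_inv, norm_norm, inv_mul_cancel₀ hB0.ne']
  have hb'1 : ‖b'‖ = 1 := by
    rw [hb', norm_smul, norm_inv, norm_norm, inv_mul_cancel₀ hB'0.ne']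
  have hbb' : ‖b - b'‖ ≤ c₁ * L := by
    rw [hb, hb']
    calc ‖‖B‖⁻¹ • B - ‖B'‖⁻¹ • B'‖ ≤ 2 * ‖B - B'‖ / ‖B‖ := norm_unit_sub_unit_le hB0 hB'0
      _ ≤ 2 * (A * L) / m := by gcongr
      _ = c₁ * L := by rw [hc₁]; ring
  -- Step 3: the tangent drifts `Bt`, `Bt'`
  have hBtA : ‖Bt‖ ≤ A := by
    rw [hBt, hA]
    exact (norm_drift_le α he T).trans (mul_le_of_le_one_right (by positivity) hT)
  have hBt'A : ‖Bt'‖ ≤ A := by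
    rw [hBt', hA]
    exact (norm_drift_le α he T').trans (mul_le_of_le_one_right (by positivity) hT')
  have hBtBt' : ‖Bt - Bt'‖ ≤ A * L := by
    rw [hBt, hBt', drift_sub, hA]
    exact (norm_drift_le α he (T - T')).trans (by gcongr)
  -- Step 4: the slips `c`, `c'`
  have hc1 : |c| ≤ 1 := by
    rw [hc]
    calc |⟪T, b⟫| ≤ ‖T‖ * ‖b‖ := abs_real_inner_le_norm _ _
      _ ≤ 1 * 1 := by rw [hb1]; gcongr
      _ = 1 := one_mul 1
  have hc'1 : |c'| ≤ 1 := by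
    rw [hc']
    calc |⟪T', b'⟫| ≤ ‖T'‖ * ‖b'‖ := abs_real_inner_le_norm _ _
      _ ≤ 1 * 1 := by rw [hb'1]; gcongr
      _ = 1 := one_mul 1
  have hcc' : |c - c'| ≤ c₃ * L := by
    rw [hc, hc']
    calc |⟪T, b⟫ - ⟪T', b'⟫| ≤ ‖T - T'‖ * ‖b‖ + ‖T'‖ * ‖b - b'‖ := abs_inner_sub_inner_le _ _ _ _
      _ ≤ L * 1 + 1 * (c₁ * L) := by rw [hb1]; gcongr
      _ = c₃ * L := by rw [hc₃]; ring
  -- Step 5: the crosses `b × Bt`, `b' × Bt'`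
  have hX : ‖cross b Bt‖ ≤ A := by
    calc ‖cross b Bt‖ ≤ ‖b‖ * ‖Bt‖ := norm_cross_le _ _
      _ ≤ 1 * A := by rw [hb1]; gcongr
      _ = A := one_mul A
  have hX' : ‖cross b' Bt'‖ ≤ A := by
    calc ‖cross b' Bt'‖ ≤ ‖b'‖ * ‖Bt'‖ := norm_cross_le _ _
      _ ≤ 1 * A := by rw [hb'1]; gcongr
      _ = A := one_mul A
  have hXX' : ‖cross b Bt - cross b' Bt'‖ ≤ c₄ * L := by
    calc ‖cross b Bt - cross b' Bt'‖ ≤ ‖b - b'‖ * ‖Bt‖ + ‖b'‖ * ‖Bt - Bt'‖ :=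
          norm_cross_sub_cross_le _ _ _ _
      _ ≤ (c₁ * L) * A + 1 * (A * L) := by rw [hb'1]; gcongr
      _ = c₄ * L := by rw [hc₄]; ring
  -- Step 6: the coefficients `k = c/β/‖B‖²`, `k'`
  obtain ⟨k, hk⟩ : ∃ k : ℝ, k = c / β / ‖B‖ ^ 2 := ⟨_, rfl⟩
  obtain ⟨k', hk'⟩ : ∃ k' : ℝ, k' = c' / β / ‖B'‖ ^ 2 := ⟨_, rfl⟩
  rw [← hk, ← hk']
  have hk'K : |k'| ≤ K := by
    rw [hk', hK, abs_div, abs_div, abs_of_pos (by positivity : (0 : ℝ) < ‖B'‖ ^ 2)]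
    gcongr
  have hkk' : |k - k'| ≤ c₅ * L := by
    have h1 : k - k' = (c * (‖B‖ ^ 2)⁻¹ - c' * (‖B'‖ ^ 2)⁻¹) / β := by rw [hk, hk']; ring
    have h2 : |c * (‖B‖ ^ 2)⁻¹ - c' * (‖B'‖ ^ 2)⁻¹| ≤ c₃ * L * (m ^ 2)⁻¹ + 1 * (A * L * (2 / m ^ 3)) := by
      calc |c * (‖B‖ ^ 2)⁻¹ - c' * (‖B'‖ ^ 2)⁻¹|
            ≤ |c - c'| * |(‖B‖ ^ 2)⁻¹| + |c'| * |(‖B‖ ^ 2)⁻¹ - (‖B'‖ ^ 2)⁻¹| :=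
            abs_mul_sub_mul_le _ _ _ _
        _ ≤ c₃ * L * (m ^ 2)⁻¹ + 1 * (|‖B‖ - ‖B'‖| * (2 / m ^ 3)) := by
            gcongr
            · rw [abs_inv, abs_of_pos (by positivity : (0 : ℝ) < ‖B‖ ^ 2)]
              exact inv_anti₀ (by positivity) (pow_le_pow_left₀ hm0.le hBm 2)
            · exact abs_inv_sq_sub_inv_sq_le hm0 hBm hB'm
        _ ≤ c₃ * L * (m ^ 2)⁻¹ + 1 * (A * L * (2 / m ^ 3)) := by
            gcongr
            exact (abs_norm_sub_norm_le B B').trans hBB'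
    rw [h1, abs_div]
    calc |c * (‖B‖ ^ 2)⁻¹ - c' * (‖B'‖ ^ 2)⁻¹| / |β|
          ≤ (c₃ * L * (m ^ 2)⁻¹ + 1 * (A * L * (2 / m ^ 3))) / βmin := by gcongr
      _ = c₅ * L := by rw [hc₅]; field_simp
  -- Step 7: the slaved parts `G = k • b × Bt`, `G'`
  have hGG' : ‖k • cross b Bt - k' • cross b' Bt'‖ ≤ c₆ * L := by
    calc ‖k • cross b Bt - k' • cross b' Bt'‖
          ≤ |k - k'| * ‖cross b Bt‖ + |k'| * ‖cross b Bt - cross b' Bt'‖ := norm_smul_sub_smul_le _ _ _ _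
      _ ≤ (c₅ * L) * A + K * (c₄ * L) := by gcongr
      _ = c₆ * L := by rw [hc₆]; ring
  have hG' : ‖k' • cross b' Bt'‖ ≤ K * A := by
    rw [norm_smul, Real.norm_eq_abs]
    exact mul_le_mul hk'K hX' (norm_nonneg _) hK0
  -- Step 8: the ripple vectors `F = T − c • b − G`, `F'`
  set F := T - c • b - k • cross b Bt with hF
  set F' := T' - c' • b' - k' • cross b' Bt' with hF'
  have hcb : ‖c • b - c' • b'‖ ≤ c₃ * L * 1 + 1 * (c₁ * L) := by
    calc ‖c • b - c' • b'‖ ≤ |c - c'| * ‖b‖ + |c'| * ‖b - b'‖ := norm_smul_sub_smul_le _ _ _ _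
      _ ≤ c₃ * L * 1 + 1 * (c₁ * L) := by rw [hb1]; gcongr
  have hFF' : ‖F - F'‖ ≤ c₇ * L := by
    have h : F - F' = (T - T') - (c • b - c' • b') - (k • cross b Bt - k' • cross b' Bt') := by
      rw [hF, hF']; abel
    rw [h]
    calc ‖(T - T') - (c • b - c' • b') - (k • cross b Bt - k' • cross b' Bt')‖
          ≤ ‖T - T'‖ + ‖c • b - c' • b'‖ + ‖k • cross b Bt - k' • cross b' Bt'‖ :=
          (norm_sub_le _ _).trans (add_le_add (norm_sub_le _ _) le_rfl)
      _ ≤ L + (c₃ * L * 1 + 1 * (c₁ * L)) + c₆ * L := by gcongr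
      _ = c₇ * L := by rw [hc₇]; ring
  have hF'b : ‖F'‖ ≤ 2 + K * A := by
    have hcb' : ‖c' • b'‖ ≤ 1 := by
      rw [norm_smul, Real.norm_eq_abs, hb'1, mul_one]; exact hc'1
    calc ‖F'‖ ≤ ‖T'‖ + ‖c' • b'‖ + ‖k' • cross b' Bt'‖ :=
          (norm_sub_le _ _).trans (add_le_add (norm_sub_le _ _) le_rfl)
      _ ≤ 1 + 1 + K * A := by gcongr
      _ = 2 + K * A := by norm_num
  -- Step 9: conclusion, `|‖F‖‖Y‖ − ‖F'‖‖Y'‖| ≤ ‖F − F'‖ ‖Y‖ + ‖F'‖ ‖Y − Y'‖`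
  have h1 : |‖F‖ - ‖F'‖| ≤ c₇ * L := (abs_norm_sub_norm_le _ _).trans hFF'
  have h2 : |‖Y‖ - ‖Y'‖| ≤ L := (abs_norm_sub_norm_le _ _).trans hdY
  calc |‖F‖ * ‖Y‖ - ‖F'‖ * ‖Y'‖|
        ≤ |‖F‖ - ‖F'‖| * |‖Y‖| + |‖F'‖| * |‖Y‖ - ‖Y'‖| := abs_mul_sub_mul_le _ _ _ _
    _ ≤ (c₇ * L) * (2 * R₃) + (2 + K * A) * L := by
        rw [abs_norm, abs_norm]
        gcongr
    _ = (c₇ * (2 * R₃) + (2 + K * A)) * L := by ring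

end Summit.NavierStokesRegularity.NavierStokesRegularity.Theorems.SkeletonEquilibrium.MirrorPointNegation
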